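import Mathlib

/-!
# `Balaban1983to89.B11Eq88Estimate` — T. Bałaban, *The variational problem and background fields in renormalization group method for lattice gauge theories*, Commun. Math. Phys. **102** (1985) 277–309 [Balaban1985Variational]: p. 291, the two estimate SENTENCES after (88) and (89) — «Applying the inequalities (3.132) from [5], (55), (73), … we can estimate this functional derivative by O(1)ε₃²(Lʲη)⁻³ on Ω_j» and «… and can be estimated by O(1)ε₃³(Lʲη)⁻³ on Ω_j» — PROVED as multiscale bookkeeping with the print's O(1) made explicit, GIVEN the printed inputs as hypotheses: the kernel bound (3.132) of [5] for (QGQ*)⁻¹, the bound (55) on D(A′), the kernel bound (73) on 𝔇(A′; c, b), the size of QA′ from (77), the boundedness of Q*, and the scale sums of Lemma 2.1 of [3] (theorem-only module)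

statement-level skeleton of published theorems with citation tags; proofs where landed; nothing here is a claim about the Yang–Mills mass gap

PDF held: `paper:balaban1985-cmp102-variational-background` (journal page = PDF page + 276).  Render
`run/shared/lean/pub/pub-balaban/b2b-balaban-ref1/pages/1985-cmp102-variational-background/…-p015-x2.png` (p. 291) READ
AS IMAGE by this seat (lit-balaban reader/typer r08, gen 4, 2026-08-21).

CITATION HEADER (lean-in-tree rule 2026-08-18).  WHAT IS REPRODUCED: SKELETON row `B11.Eq85` = displays (85)–(96)
pp. 291–292; this module adds the two O(1)-ESTIMATE SENTENCES of p. 291 (for the displays (88) and (89)), which the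
gen-2 module `B11Eq85FirstDerivative` left untyped («NOT typed: the O(1)ε₃²/ε₃³(Lʲη)⁻³ estimate sentences of (88)/(89)
rest on [5] (3.132)»).  Sibling modules: `B11Eq85FirstDerivative` ((85)–(90), (92): the operator identities (87)/(89),
the differentiation rules, and the bookkeeping `ineq86` of (86) whose style — scale sums of Lemma 2.1 [3] as
hypotheses, O(1) explicit — this file follows), `B11Eq73KernelDecay` ((73)), `B11Eq63FunctionalDerivative` ((63)–(70),
the pairing (66) «Σ_{c′∈𝔅_k}(L^{j′}η)^d …»), `B9` (`B9.Ineq3132` = (3.132) of [5], row `B9.Eq3.132`).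

THE PRINT (p. 291 [PDF 15], verbatim from the render).  «For the second term we have
  ⟨A′, Δ_πHD(A′)⟩ = ⟨A′, (Δ_π + DRD*)HD(A′)⟩ = ⟨A′, (G⁻¹ − Q*aQ)GQ*(QGQ*)⁻¹(L^{j(·)}η)⁻¹D(A′)⟩
   = ⟨A′, Q*(QGQ*)⁻¹(L^{j(·)}η)⁻¹D(A′)⟩ − ⟨A′, Q*a(L^{j(·)}η)⁻¹D(A′)⟩, (87)
hence the functional derivative is equal to
  Q*(QGQ*)⁻¹(L^{j(·)}η)⁻¹D(A′) − Q*a(L^{j(·)}η)⁻¹D(A′) + 𝔇*(A′)(L^{j(·)}η)⁻¹(QGQ*)⁻¹QA′ − 𝔇*(A′)(L^{j(·)}η)⁻¹aQA′. (88)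
Applying the inequalities (3.132) from [5], (55), (73), and remembering that the symbol a above represents the operator
of multiplication by (L^{j(·)}η)⁻² (we put the constant a = 1), we can estimate this functional derivative by
O(1)ε₃²(Lʲη)⁻³ on Ω_j.  The functional derivative of the third term in V(A′) is equal to
  𝔇*(A′)H*Δ_πHD(A′) = 𝔇*(A′)(L^{j(·)}η)⁻¹(QGQ*)⁻¹(L^{j(·)}η)⁻¹D(A′) [−] 𝔇*(A′)(L^{j(·)}η)⁻⁴D(A′), (89)
and can be estimated by O(1)ε₃³(Lʲη)⁻³ on Ω_j.»  (The sign in (89) is not printed; (87)/(137) force a minus —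
`B11Eq85FirstDerivative.inner89`; irrelevant for the norm estimate.)  The printed inputs: [5] (3.132) «|(QGQ*)⁻¹(y, y′)|
≦ O(1)(Lʲη)⁻²(L^{j′}η)^{−d}e^{−δ₁d(y,y′)}»; (55) «|D(A′)| ≦ 4C₂|A′|²₍₋₁₎» (hence `< 4C₂ε₃²` under (77)); (73)
«|𝔇(A′; c, b)| ≦ O(1)C₃ε₃(Lʲη)^{−d+1}e^{−(1/2)δ₀d(c₋,y)}, b ∈ Bʲ(y), y ∈ Λ_j»; (77) «|A′| < ε₃(Lʲη)⁻¹»; the pairing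
(66) «Σ_{c′∈𝔅_k}(L^{j′}η)^d H(b′, c′)𝔇(A′; c′, b)» (kernels act with the weight `(L^{j′}η)^d` on `𝔅_k`).

DICTIONARY (abstract; nothing re-declared; «matrix indices suppressed» as in the print — scalar kernels and entries,
the matrix version being the same estimate entrywise).  A bond `b ∈ Bʲ(y)`, `y ∈ Λ_j`, of scale `t = Lʲη > 0` is
fixed.  `Ys : Finset Y` = the sites `y′ ∈ 𝔅_k` with scale `w y′ = L^{j′}η`; `Cs : Finset C` = the sites `c ∈ 𝔅_k`
(arguments of `D`, `𝔇`) with scale `v c = L^{j(c)}η`; `kQ y′` = the kernel entry `(QGQ*)⁻¹(y, y′)` (row `y`) resp.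
`kQc c y′ = (QGQ*)⁻¹(c, y′)` (row `c`); `Dv y′ = D(A′)(y′)`; `QA y′ = (QA′)(y′)`; `Dk c = 𝔇(A′; c, b)`; `q` = the
factor by which `Q*` transports a site value to the bond `b` (`|q| ≦ q₀`, the boundedness of the adjoint average);
`dY y′ = d(y, y′)`, `dYc c y′ = d(c, y′)`, `dC c = d(c₋, y)`.  HYPOTHESES = the printed inputs: `h3132`/`h3132c`
((3.132) with constant `O₁`, decay `δ₁`), `h55` (`|D(A′)(y′)| ≦ 4C₂ε₃²`), `h73` ((73) with constant `O₂C₃ε₃`),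
`hQA` (`|(QA′)(y′)| ≦ ε₃(L^{j′}η)⁻¹`, the average does not increase the sup norm (77)), and the Lemma 2.1 [3] scale
sums `hL1 : Σ_{y′}e^{−δ₁d(y,y′)}(L^{j′}η)⁻¹ ≦ K₁(Lʲη)⁻¹` (resp. around `c`), `hL2 : Σ_{c}(L^{j(c)}η)^{d−4}
e^{−(1/2)δ₀d(c₋,y)} ≦ K₂(Lʲη)^{d−4}` — the sums the print's «O(1)» absorbs.

WHAT IS CERTIFIED (kernel, sorry-free; axioms `propext` / `Classical.choice` / `Quot.sound`).
§1 `kernel3132_sum_le` — the (3.132)-kernel applied to a site function of size `M(L^{j′}η)⁻¹`: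
`|Σ_{y′}(L^{j′}η)^d (QGQ*)⁻¹(s; y′) g(y′)| ≦ O₁·M·K·s⁻³` (`s` = the scale of the row site).
§2 `dstar73_sum_le` — the (73)-kernel `𝔇*` applied to a function of size `Φ(L^{j(c)}η)⁻⁴`:
`|Σ_c (L^{j(c)}η)^d 𝔇(A′; c, b) F(c)| ≦ O₂C₃ε₃·Φ·K₂·(Lʲη)⁻³`.
§3 the four terms of (88): `ineq88_term1` (`q₀O₁4C₂K₁·ε₃²(Lʲη)⁻³`), `ineq88_term2` (`q₀4C₂·ε₃²(Lʲη)⁻³`),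
`phi88_term3` (the inner function `(L^{j(·)}η)⁻¹(QGQ*)⁻¹QA′` has size `O₁K₁ε₃·(L^{j(c)}η)⁻⁴`), `ineq88_term3`
(`O₂C₃O₁K₁K₂·ε₃²(Lʲη)⁻³`), `ineq88_term4` (`O₂C₃K₂·ε₃²(Lʲη)⁻³`); **(88) estimate sentence** `ineq88`:
`|(88)(b)| ≦ (q₀O₁4C₂K₁ + q₀4C₂ + O₂C₃O₁K₁K₂ + O₂C₃K₂)·ε₃²·(Lʲη)⁻³` = the print's «O(1)ε₃²(Lʲη)⁻³».
§4 **(89) estimate sentence** `phi89_term1`, `ineq89`: `|(89)(b)| ≦ (O₂C₃O₁K₁K₂4C₂ + O₂C₃K₂4C₂)·ε₃³·(Lʲη)⁻³`.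

HONEST SCOPE — what is NOT claimed.  (i) (3.132), (55), (73), the boundedness of `Q*` and of the average (`hQA`), and
the two Lemma 2.1 scale sums are HYPOTHESES (rows `B9.Eq3.132`, `B11.Eq55`, `B11.Eq73`, `B6.Lem2.1`); this module
certifies only the printed passage «Applying the inequalities (3.132) from [5], (55), (73) … we can estimate … by
O(1)ε₃²(Lʲη)⁻³» and its (89) analogue, with O(1) explicit in the displayed constants.  (ii) The lattice operators
(`Q`, `G`, `D`, `𝔇`) are not constructed; the four terms of (88) enter as the finite sums the kernels define ((66)).
(iii) Scalar entries («matrix indices suppressed»).  (iv) That the functional derivative of ⟨A′, Δ_πHD(A′)⟩ IS (88) is the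
differentiation rule `B11Eq85FirstDerivative.hasFDerivAt88(_apply)`; not repeated here.  Unit `lit-balaban-r08` gen 4
(`HOME/lit-balaban-r08/ROWS-B11.md` row B11.Eq85).
-/

namespace Literature.MathematicalPhysics.QuantumFieldTheory.Balaban1983to89.B11Eq88Estimate

open Finset Real

variable {Y C : Type*}

/-! ## §1 The (3.132)-kernel sum -/

/-- **(3.132) [5] applied**, p. 291: for a row site of scale `s` (`= Lʲη` or `L^{j(c)}η`), the kernel `(QGQ*)⁻¹(·, y′)`
with «|(QGQ*)⁻¹(y, y′)| ≦ O(1)(Lʲη)⁻²(L^{j′}η)^{−d}e^{−δ₁d(y,y′)}» applied (with the pairing weight `(L^{j′}η)^d`) to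
a site function `g` of size `|g(y′)| ≦ M(L^{j′}η)⁻¹` is bounded by `O₁·M·K·s⁻³`, given the Lemma 2.1 [3] scale sum
`Σ_{y′}e^{−δ₁d(y,y′)}(L^{j′}η)⁻¹ ≦ K s⁻¹`. [cite: Balaban1985Variational, (88) p.291] -/
theorem kernel3132_sum_le (Ys : Finset Y) (w k g dY : Y → ℝ) (d : ℕ) (s O₁ δ₁ M K : ℝ)
    (hs : 0 < s) (hw : ∀ y ∈ Ys, 0 < w y) (hO : 0 ≤ O₁) (hM : 0 ≤ M)
    (hk : ∀ y ∈ Ys, |k y| ≤ O₁ * s ^ (-2 : ℤ) * w y ^ (-(d : ℤ)) * exp (-(δ₁ * dY y)))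
    (hg : ∀ y ∈ Ys, |g y| ≤ M * w y ^ (-1 : ℤ))
    (hL : ∑ y ∈ Ys, exp (-(δ₁ * dY y)) * w y ^ (-1 : ℤ) ≤ K * s ^ (-1 : ℤ)) :
    |∑ y ∈ Ys, w y ^ (d : ℤ) * k y * g y| ≤ O₁ * M * K * s ^ (-3 : ℤ) := by
  have hs2 : 0 ≤ s ^ (-2 : ℤ) := by positivity
  -- termwise bound
  have hterm : ∀ y ∈ Ys, |w y ^ (d : ℤ) * k y * g y| ≤
      O₁ * s ^ (-2 : ℤ) * M * (exp (-(δ₁ * dY y)) * w y ^ (-1 : ℤ)) := by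
    intro y hy
    have hwpos : 0 < w y := hw y hy
    have hw0 : w y ≠ 0 := hwpos.ne'
    have hwd : 0 < w y ^ (d : ℤ) := zpow_pos hwpos _
    rw [abs_mul, abs_mul, abs_of_pos hwd]
    have h1 : w y ^ (d : ℤ) * |k y| ≤ w y ^ (d : ℤ) * (O₁ * s ^ (-2 : ℤ) * w y ^ (-(d : ℤ)) * exp (-(δ₁ * dY y))) :=
      mul_le_mul_of_nonneg_left (hk y hy) hwd.le
    have e1 : w y ^ (d : ℤ) * (O₁ * s ^ (-2 : ℤ) * w y ^ (-(d : ℤ)) * exp (-(δ₁ * dY y))) =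
        O₁ * s ^ (-2 : ℤ) * exp (-(δ₁ * dY y)) := by
      have : w y ^ (d : ℤ) * w y ^ (-(d : ℤ)) = 1 := by
        rw [← zpow_add₀ hw0]; simp
      calc w y ^ (d : ℤ) * (O₁ * s ^ (-2 : ℤ) * w y ^ (-(d : ℤ)) * exp (-(δ₁ * dY y)))
          = O₁ * s ^ (-2 : ℤ) * exp (-(δ₁ * dY y)) * (w y ^ (d : ℤ) * w y ^ (-(d : ℤ))) := by ring
        _ = O₁ * s ^ (-2 : ℤ) * exp (-(δ₁ * dY y)) := by rw [this, mul_one]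
    have hA : 0 ≤ w y ^ (d : ℤ) * |k y| := mul_nonneg hwd.le (abs_nonneg _)
    have hB : 0 ≤ O₁ * s ^ (-2 : ℤ) * exp (-(δ₁ * dY y)) := by positivity
    calc w y ^ (d : ℤ) * |k y| * |g y|
        ≤ (O₁ * s ^ (-2 : ℤ) * exp (-(δ₁ * dY y))) * (M * w y ^ (-1 : ℤ)) := by
          apply mul_le_mul (h1.trans_eq e1) (hg y hy) (abs_nonneg _) hB
      _ = O₁ * s ^ (-2 : ℤ) * M * (exp (-(δ₁ * dY y)) * w y ^ (-1 : ℤ)) := by ring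
  calc |∑ y ∈ Ys, w y ^ (d : ℤ) * k y * g y|
      ≤ ∑ y ∈ Ys, |w y ^ (d : ℤ) * k y * g y| := abs_sum_le_sum_abs _ _
    _ ≤ ∑ y ∈ Ys, O₁ * s ^ (-2 : ℤ) * M * (exp (-(δ₁ * dY y)) * w y ^ (-1 : ℤ)) := sum_le_sum hterm
    _ = O₁ * s ^ (-2 : ℤ) * M * ∑ y ∈ Ys, exp (-(δ₁ * dY y)) * w y ^ (-1 : ℤ) := by rw [mul_sum]
    _ ≤ O₁ * s ^ (-2 : ℤ) * M * (K * s ^ (-1 : ℤ)) := by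
          apply mul_le_mul_of_nonneg_left hL; positivity
    _ = O₁ * M * K * (s ^ (-2 : ℤ) * s ^ (-1 : ℤ)) := by ring
    _ = O₁ * M * K * s ^ (-3 : ℤ) := by rw [← zpow_add₀ hs.ne']; norm_num

/-! ## §2 The (73)-kernel (`𝔇*`) sum -/

/-- **(73) applied as `𝔇*`**, p. 291: with the pairing (66) on `𝔅_k` (weight `(L^{j(c)}η)^d`), the kernel bound (73)
«|𝔇(A′; c, b)| ≦ O(1)C₃ε₃(Lʲη)^{−d+1}e^{−(1/2)δ₀d(c₋,y)}» (`b ∈ Bʲ(y)`, `t = Lʲη`), a site function `F` of size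
`|F(c)| ≦ Φ(L^{j(c)}η)⁻⁴`, and the Lemma 2.1 [3] scale sum `Σ_c(L^{j(c)}η)^{d−4}e^{−(1/2)δ₀d(c₋,y)} ≦ K₂(Lʲη)^{d−4}`:
`|Σ_c(L^{j(c)}η)^d 𝔇(A′; c, b)F(c)| ≦ O₂C₃ε₃·Φ·K₂·(Lʲη)⁻³`. [cite: Balaban1985Variational, (88) p.291] -/
theorem dstar73_sum_le (Cs : Finset C) (v Dk F dC : C → ℝ) (d : ℕ) (t O₂C₃ε₃ δ Φ K₂ : ℝ)
    (ht : 0 < t) (hv : ∀ c ∈ Cs, 0 < v c) (hO : 0 ≤ O₂C₃ε₃) (hΦ : 0 ≤ Φ)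
    (hD : ∀ c ∈ Cs, |Dk c| ≤ O₂C₃ε₃ * t ^ (1 - (d : ℤ)) * exp (-(δ * dC c)))
    (hF : ∀ c ∈ Cs, |F c| ≤ Φ * v c ^ (-4 : ℤ))
    (hL : ∑ c ∈ Cs, v c ^ ((d : ℤ) - 4) * exp (-(δ * dC c)) ≤ K₂ * t ^ ((d : ℤ) - 4)) :
    |∑ c ∈ Cs, v c ^ (d : ℤ) * Dk c * F c| ≤ O₂C₃ε₃ * Φ * K₂ * t ^ (-3 : ℤ) := by
  have ht1 : 0 ≤ t ^ (1 - (d : ℤ)) := by positivity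
  have hterm : ∀ c ∈ Cs, |v c ^ (d : ℤ) * Dk c * F c| ≤
      O₂C₃ε₃ * t ^ (1 - (d : ℤ)) * Φ * (v c ^ ((d : ℤ) - 4) * exp (-(δ * dC c))) := by
    intro c hc
    have hvpos : 0 < v c := hv c hc
    have hv0 : v c ≠ 0 := hvpos.ne'
    have hvd : 0 < v c ^ (d : ℤ) := zpow_pos hvpos _
    rw [abs_mul, abs_mul, abs_of_pos hvd]
    have h1 : v c ^ (d : ℤ) * |Dk c| ≤ v c ^ (d : ℤ) * (O₂C₃ε₃ * t ^ (1 - (d : ℤ)) * exp (-(δ * dC c))) :=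
      mul_le_mul_of_nonneg_left (hD c hc) hvd.le
    have hA : 0 ≤ v c ^ (d : ℤ) * (O₂C₃ε₃ * t ^ (1 - (d : ℤ)) * exp (-(δ * dC c))) := by positivity
    have e2 : v c ^ (d : ℤ) * v c ^ (-4 : ℤ) = v c ^ ((d : ℤ) - 4) := by
      rw [← zpow_add₀ hv0]; ring_nf
    calc v c ^ (d : ℤ) * |Dk c| * |F c|
        ≤ (v c ^ (d : ℤ) * (O₂C₃ε₃ * t ^ (1 - (d : ℤ)) * exp (-(δ * dC c)))) * (Φ * v c ^ (-4 : ℤ)) := by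
          apply mul_le_mul h1 (hF c hc) (abs_nonneg _) hA
      _ = O₂C₃ε₃ * t ^ (1 - (d : ℤ)) * Φ * ((v c ^ (d : ℤ) * v c ^ (-4 : ℤ)) * exp (-(δ * dC c))) := by ring
      _ = O₂C₃ε₃ * t ^ (1 - (d : ℤ)) * Φ * (v c ^ ((d : ℤ) - 4) * exp (-(δ * dC c))) := by rw [e2]
  calc |∑ c ∈ Cs, v c ^ (d : ℤ) * Dk c * F c|
      ≤ ∑ c ∈ Cs, |v c ^ (d : ℤ) * Dk c * F c| := abs_sum_le_sum_abs _ _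
    _ ≤ ∑ c ∈ Cs, O₂C₃ε₃ * t ^ (1 - (d : ℤ)) * Φ * (v c ^ ((d : ℤ) - 4) * exp (-(δ * dC c))) := sum_le_sum hterm
    _ = O₂C₃ε₃ * t ^ (1 - (d : ℤ)) * Φ * ∑ c ∈ Cs, v c ^ ((d : ℤ) - 4) * exp (-(δ * dC c)) := by rw [mul_sum]
    _ ≤ O₂C₃ε₃ * t ^ (1 - (d : ℤ)) * Φ * (K₂ * t ^ ((d : ℤ) - 4)) := by
          apply mul_le_mul_of_nonneg_left hL; positivity
    _ = O₂C₃ε₃ * Φ * K₂ * (t ^ (1 - (d : ℤ)) * t ^ ((d : ℤ) - 4)) := by ring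
    _ = O₂C₃ε₃ * Φ * K₂ * t ^ (-3 : ℤ) := by rw [← zpow_add₀ ht.ne']; ring_nf

/-! ## §3 The four terms of (88) and the estimate sentence -/

/-- **(88), first term** `Q*(QGQ*)⁻¹(L^{j(·)}η)⁻¹D(A′)` at the bond `b ∈ Bʲ(y)`: the adjoint average transports the
site value to the bond with a factor `q`, `|q| ≦ q₀`; the site value is the (3.132)-kernel sum applied to
`(L^{j′}η)⁻¹D(A′)(y′)` with «|D(A′)| ≦ 4C₂|A′|²₍₋₁₎ < 4C₂ε₃²» (55): `|term₁| ≦ q₀·O₁·4C₂ε₃²·K₁·(Lʲη)⁻³`.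
[cite: Balaban1985Variational, (88) p.291] -/
theorem ineq88_term1 (Ys : Finset Y) (w kQ Dv dY : Y → ℝ) (d : ℕ) (t q q₀ O₁ δ₁ C₂ ε₃ K₁ : ℝ)
    (ht : 0 < t) (hw : ∀ y ∈ Ys, 0 < w y) (hO : 0 ≤ O₁) (hC : 0 ≤ C₂) (hq : |q| ≤ q₀)
    (h3132 : ∀ y ∈ Ys, |kQ y| ≤ O₁ * t ^ (-2 : ℤ) * w y ^ (-(d : ℤ)) * exp (-(δ₁ * dY y)))
    (h55 : ∀ y ∈ Ys, |Dv y| ≤ 4 * C₂ * ε₃ ^ 2)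
    (hL1 : ∑ y ∈ Ys, exp (-(δ₁ * dY y)) * w y ^ (-1 : ℤ) ≤ K₁ * t ^ (-1 : ℤ)) :
    |q * ∑ y ∈ Ys, w y ^ (d : ℤ) * kQ y * (w y ^ (-1 : ℤ) * Dv y)|
      ≤ q₀ * (O₁ * (4 * C₂ * ε₃ ^ 2) * K₁ * t ^ (-3 : ℤ)) := by
  have hM : 0 ≤ 4 * C₂ * ε₃ ^ 2 := by positivity
  have hg : ∀ y ∈ Ys, |w y ^ (-1 : ℤ) * Dv y| ≤ 4 * C₂ * ε₃ ^ 2 * w y ^ (-1 : ℤ) := by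
    intro y hy
    have hw1 : 0 < w y ^ (-1 : ℤ) := zpow_pos (hw y hy) _
    rw [abs_mul, abs_of_pos hw1]
    calc w y ^ (-1 : ℤ) * |Dv y| ≤ w y ^ (-1 : ℤ) * (4 * C₂ * ε₃ ^ 2) :=
          mul_le_mul_of_nonneg_left (h55 y hy) hw1.le
      _ = 4 * C₂ * ε₃ ^ 2 * w y ^ (-1 : ℤ) := by ring
  have hS := kernel3132_sum_le Ys w kQ (fun y => w y ^ (-1 : ℤ) * Dv y) dY d t O₁ δ₁ (4 * C₂ * ε₃ ^ 2) K₁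
    ht hw hO hM h3132 hg hL1
  have hS0 : 0 ≤ O₁ * (4 * C₂ * ε₃ ^ 2) * K₁ * t ^ (-3 : ℤ) := le_trans (abs_nonneg _) hS
  rw [abs_mul]
  exact mul_le_mul hq hS (abs_nonneg _) (le_trans (abs_nonneg _) hq)

/-- **(88), second term** `Q*a(L^{j(·)}η)⁻¹D(A′)` at `b ∈ Bʲ(y)`: «the symbol a above represents the operator of
multiplication by (L^{j(·)}η)⁻² (we put the constant a = 1)», so the site value is `(Lʲη)⁻²(Lʲη)⁻¹D(A′)(y)` with (55):
`|term₂| ≦ q₀·4C₂ε₃²·(Lʲη)⁻³`. [cite: Balaban1985Variational, (88) p.291] -/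
theorem ineq88_term2 (t q q₀ C₂ ε₃ D0 : ℝ) (ht : 0 < t) (hq : |q| ≤ q₀) (h55 : |D0| ≤ 4 * C₂ * ε₃ ^ 2) :
    |q * (t ^ (-2 : ℤ) * (t ^ (-1 : ℤ) * D0))| ≤ q₀ * (4 * C₂ * ε₃ ^ 2 * t ^ (-3 : ℤ)) := by
  have ht2 : 0 < t ^ (-2 : ℤ) := zpow_pos ht _
  have ht1 : 0 < t ^ (-1 : ℤ) := zpow_pos ht _
  have e : t ^ (-2 : ℤ) * t ^ (-1 : ℤ) = t ^ (-3 : ℤ) := by rw [← zpow_add₀ ht.ne']; norm_num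
  have hin : |t ^ (-2 : ℤ) * (t ^ (-1 : ℤ) * D0)| ≤ 4 * C₂ * ε₃ ^ 2 * t ^ (-3 : ℤ) := by
    rw [abs_mul, abs_mul, abs_of_pos ht2, abs_of_pos ht1]
    calc t ^ (-2 : ℤ) * (t ^ (-1 : ℤ) * |D0|) ≤ t ^ (-2 : ℤ) * (t ^ (-1 : ℤ) * (4 * C₂ * ε₃ ^ 2)) := by
          apply mul_le_mul_of_nonneg_left _ ht2.le
          exact mul_le_mul_of_nonneg_left h55 ht1.le
      _ = 4 * C₂ * ε₃ ^ 2 * (t ^ (-2 : ℤ) * t ^ (-1 : ℤ)) := by ring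
      _ = 4 * C₂ * ε₃ ^ 2 * t ^ (-3 : ℤ) := by rw [e]
  rw [abs_mul]
  exact mul_le_mul hq hin (abs_nonneg _) (le_trans (abs_nonneg _) hq)

/-- **(88), the inner function of the third term** `(L^{j(·)}η)⁻¹(QGQ*)⁻¹QA′` at a site `c` of scale `v_c = L^{j(c)}η`:
(3.132) for the row `c` and «|A′| < ε₃(Lʲη)⁻¹» (77) for the averages `QA′` (`|(QA′)(y′)| ≦ ε₃(L^{j′}η)⁻¹`) give the
size `O₁K₁ε₃·(L^{j(c)}η)⁻⁴`. [cite: Balaban1985Variational, (88) p.291] -/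
theorem phi88_term3 (Ys : Finset Y) (w kQc QA dYc : Y → ℝ) (d : ℕ) (vc O₁ δ₁ ε₃ K₁ : ℝ)
    (hvc : 0 < vc) (hw : ∀ y ∈ Ys, 0 < w y) (hO : 0 ≤ O₁) (hε : 0 ≤ ε₃)
    (h3132c : ∀ y ∈ Ys, |kQc y| ≤ O₁ * vc ^ (-2 : ℤ) * w y ^ (-(d : ℤ)) * exp (-(δ₁ * dYc y)))
    (hQA : ∀ y ∈ Ys, |QA y| ≤ ε₃ * w y ^ (-1 : ℤ))
    (hL1c : ∑ y ∈ Ys, exp (-(δ₁ * dYc y)) * w y ^ (-1 : ℤ) ≤ K₁ * vc ^ (-1 : ℤ)) :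
    |vc ^ (-1 : ℤ) * ∑ y ∈ Ys, w y ^ (d : ℤ) * kQc y * QA y| ≤ O₁ * K₁ * ε₃ * vc ^ (-4 : ℤ) := by
  have hS := kernel3132_sum_le Ys w kQc QA dYc d vc O₁ δ₁ ε₃ K₁ hvc hw hO hε h3132c hQA hL1c
  have hv1 : 0 < vc ^ (-1 : ℤ) := zpow_pos hvc _
  have e : vc ^ (-1 : ℤ) * vc ^ (-3 : ℤ) = vc ^ (-4 : ℤ) := by rw [← zpow_add₀ hvc.ne']; norm_num
  rw [abs_mul, abs_of_pos hv1]
  calc vc ^ (-1 : ℤ) * |∑ y ∈ Ys, w y ^ (d : ℤ) * kQc y * QA y| ≤ vc ^ (-1 : ℤ) * (O₁ * ε₃ * K₁ * vc ^ (-3 : ℤ)) :=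
        mul_le_mul_of_nonneg_left hS hv1.le
    _ = O₁ * K₁ * ε₃ * (vc ^ (-1 : ℤ) * vc ^ (-3 : ℤ)) := by ring
    _ = O₁ * K₁ * ε₃ * vc ^ (-4 : ℤ) := by rw [e]

/-- **(88), third term** `𝔇*(A′)(L^{j(·)}η)⁻¹(QGQ*)⁻¹QA′` at `b ∈ Bʲ(y)`: the `𝔇*`-sum of §2 with the inner size
`Φ = O₁K₁ε₃` of `phi88_term3`: `|term₃| ≦ O₂C₃ε₃·O₁K₁ε₃·K₂·(Lʲη)⁻³`. [cite: Balaban1985Variational, (88) p.291] -/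
theorem ineq88_term3 (Cs : Finset C) (v Dk F₃ dC : C → ℝ) (d : ℕ) (t O₂C₃ δ ε₃ O₁ K₁ K₂ : ℝ)
    (ht : 0 < t) (hv : ∀ c ∈ Cs, 0 < v c) (hO₂ : 0 ≤ O₂C₃) (hε : 0 ≤ ε₃) (hO₁ : 0 ≤ O₁) (hK₁ : 0 ≤ K₁)
    (h73 : ∀ c ∈ Cs, |Dk c| ≤ O₂C₃ * ε₃ * t ^ (1 - (d : ℤ)) * exp (-(δ * dC c)))
    (hF₃ : ∀ c ∈ Cs, |F₃ c| ≤ O₁ * K₁ * ε₃ * v c ^ (-4 : ℤ))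
    (hL2 : ∑ c ∈ Cs, v c ^ ((d : ℤ) - 4) * exp (-(δ * dC c)) ≤ K₂ * t ^ ((d : ℤ) - 4)) :
    |∑ c ∈ Cs, v c ^ (d : ℤ) * Dk c * F₃ c| ≤ O₂C₃ * ε₃ * (O₁ * K₁ * ε₃) * K₂ * t ^ (-3 : ℤ) :=
  dstar73_sum_le Cs v Dk F₃ dC d t (O₂C₃ * ε₃) δ (O₁ * K₁ * ε₃) K₂ ht hv (by positivity) (by positivity) h73 hF₃ hL2

/-- **(88), fourth term** `𝔇*(A′)(L^{j(·)}η)⁻¹aQA′` at `b ∈ Bʲ(y)`: inner size `(L^{j(c)}η)⁻¹(L^{j(c)}η)⁻²·ε₃(L^{j(c)}η)⁻¹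
= ε₃(L^{j(c)}η)⁻⁴` («a … multiplication by (L^{j(·)}η)⁻²», `|QA′| ≦ ε₃(L^{j(c)}η)⁻¹`), then the `𝔇*`-sum of §2:
`|term₄| ≦ O₂C₃ε₃·ε₃·K₂·(Lʲη)⁻³`. [cite: Balaban1985Variational, (88) p.291] -/
theorem ineq88_term4 (Cs : Finset C) (v Dk QAc dC : C → ℝ) (d : ℕ) (t O₂C₃ δ ε₃ K₂ : ℝ)
    (ht : 0 < t) (hv : ∀ c ∈ Cs, 0 < v c) (hO₂ : 0 ≤ O₂C₃) (hε : 0 ≤ ε₃)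
    (h73 : ∀ c ∈ Cs, |Dk c| ≤ O₂C₃ * ε₃ * t ^ (1 - (d : ℤ)) * exp (-(δ * dC c)))
    (hQAc : ∀ c ∈ Cs, |QAc c| ≤ ε₃ * v c ^ (-1 : ℤ))
    (hL2 : ∑ c ∈ Cs, v c ^ ((d : ℤ) - 4) * exp (-(δ * dC c)) ≤ K₂ * t ^ ((d : ℤ) - 4)) :
    |∑ c ∈ Cs, v c ^ (d : ℤ) * Dk c * (v c ^ (-1 : ℤ) * (v c ^ (-2 : ℤ) * QAc c))|
      ≤ O₂C₃ * ε₃ * ε₃ * K₂ * t ^ (-3 : ℤ) := by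
  have hF : ∀ c ∈ Cs, |v c ^ (-1 : ℤ) * (v c ^ (-2 : ℤ) * QAc c)| ≤ ε₃ * v c ^ (-4 : ℤ) := by
    intro c hc
    have hvpos : 0 < v c := hv c hc
    have hv1 : 0 < v c ^ (-1 : ℤ) := zpow_pos hvpos _
    have hv2 : 0 < v c ^ (-2 : ℤ) := zpow_pos hvpos _
    have e : v c ^ (-1 : ℤ) * v c ^ (-2 : ℤ) * v c ^ (-1 : ℤ) = v c ^ (-4 : ℤ) := by
      rw [← zpow_add₀ hvpos.ne', ← zpow_add₀ hvpos.ne']; norm_num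
    rw [abs_mul, abs_mul, abs_of_pos hv1, abs_of_pos hv2]
    calc v c ^ (-1 : ℤ) * (v c ^ (-2 : ℤ) * |QAc c|) ≤ v c ^ (-1 : ℤ) * (v c ^ (-2 : ℤ) * (ε₃ * v c ^ (-1 : ℤ))) := by
          apply mul_le_mul_of_nonneg_left _ hv1.le
          exact mul_le_mul_of_nonneg_left (hQAc c hc) hv2.le
      _ = ε₃ * (v c ^ (-1 : ℤ) * v c ^ (-2 : ℤ) * v c ^ (-1 : ℤ)) := by ring
      _ = ε₃ * v c ^ (-4 : ℤ) := by rw [e]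
  exact dstar73_sum_le Cs v Dk (fun c => v c ^ (-1 : ℤ) * (v c ^ (-2 : ℤ) * QAc c)) dC d t (O₂C₃ * ε₃) δ ε₃ K₂ ht hv
    (by positivity) hε h73 hF hL2

/-- **The estimate sentence of (88)**, p. 291: «Applying the inequalities (3.132) from [5], (55), (73), and remembering
that the symbol a above represents the operator of multiplication by (L^{j(·)}η)⁻² (we put the constant a = 1), we can
estimate this functional derivative by O(1)ε₃²(Lʲη)⁻³ on Ω_j» — with the four terms bounded as in `ineq88_term1…4`,
the value of (88) at `b ∈ Bʲ(y)` (`t = Lʲη`) satisfies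
`|(88)(b)| ≦ (q₀O₁4C₂K₁ + q₀4C₂ + O₂C₃O₁K₁K₂ + O₂C₃K₂)·ε₃²·(Lʲη)⁻³`, the print's O(1) made explicit.
[cite: Balaban1985Variational, (88) p.291] -/
theorem ineq88 (T₁ T₂ T₃ T₄ t q₀ O₁ C₂ K₁ O₂C₃ K₂ ε₃ : ℝ)
    (h₁ : |T₁| ≤ q₀ * (O₁ * (4 * C₂ * ε₃ ^ 2) * K₁ * t ^ (-3 : ℤ)))
    (h₂ : |T₂| ≤ q₀ * (4 * C₂ * ε₃ ^ 2 * t ^ (-3 : ℤ)))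
    (h₃ : |T₃| ≤ O₂C₃ * ε₃ * (O₁ * K₁ * ε₃) * K₂ * t ^ (-3 : ℤ))
    (h₄ : |T₄| ≤ O₂C₃ * ε₃ * ε₃ * K₂ * t ^ (-3 : ℤ)) :
    |T₁ - T₂ + T₃ - T₄| ≤
      (q₀ * O₁ * 4 * C₂ * K₁ + q₀ * 4 * C₂ + O₂C₃ * O₁ * K₁ * K₂ + O₂C₃ * K₂) * ε₃ ^ 2 * t ^ (-3 : ℤ) := by
  have hsum : |T₁ - T₂ + T₃ - T₄| ≤ |T₁| + |T₂| + |T₃| + |T₄| := by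
    calc |T₁ - T₂ + T₃ - T₄| ≤ |T₁ - T₂ + T₃| + |T₄| := abs_sub _ _
      _ ≤ |T₁ - T₂| + |T₃| + |T₄| := by gcongr; exact abs_add_le _ _
      _ ≤ |T₁| + |T₂| + |T₃| + |T₄| := by gcongr; exact abs_sub _ _
  calc |T₁ - T₂ + T₃ - T₄| ≤ |T₁| + |T₂| + |T₃| + |T₄| := hsum
    _ ≤ q₀ * (O₁ * (4 * C₂ * ε₃ ^ 2) * K₁ * t ^ (-3 : ℤ)) + q₀ * (4 * C₂ * ε₃ ^ 2 * t ^ (-3 : ℤ))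
        + O₂C₃ * ε₃ * (O₁ * K₁ * ε₃) * K₂ * t ^ (-3 : ℤ) + O₂C₃ * ε₃ * ε₃ * K₂ * t ^ (-3 : ℤ) := by
          gcongr
    _ = (q₀ * O₁ * 4 * C₂ * K₁ + q₀ * 4 * C₂ + O₂C₃ * O₁ * K₁ * K₂ + O₂C₃ * K₂) * ε₃ ^ 2 * t ^ (-3 : ℤ) := by
          ring

/-! ## §4 The estimate sentence of (89) -/

/-- **(89), the inner function of the first term** `(L^{j(·)}η)⁻¹(QGQ*)⁻¹(L^{j(·)}η)⁻¹D(A′)` at a site `c` of scale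
`v_c`: (3.132) for the row `c` and (55) give the size `O₁K₁4C₂ε₃²·(L^{j(c)}η)⁻⁴`.
[cite: Balaban1985Variational, (89) p.291] -/
theorem phi89_term1 (Ys : Finset Y) (w kQc Dv dYc : Y → ℝ) (d : ℕ) (vc O₁ δ₁ C₂ ε₃ K₁ : ℝ)
    (hvc : 0 < vc) (hw : ∀ y ∈ Ys, 0 < w y) (hO : 0 ≤ O₁) (hC : 0 ≤ C₂)
    (h3132c : ∀ y ∈ Ys, |kQc y| ≤ O₁ * vc ^ (-2 : ℤ) * w y ^ (-(d : ℤ)) * exp (-(δ₁ * dYc y)))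
    (h55 : ∀ y ∈ Ys, |Dv y| ≤ 4 * C₂ * ε₃ ^ 2)
    (hL1c : ∑ y ∈ Ys, exp (-(δ₁ * dYc y)) * w y ^ (-1 : ℤ) ≤ K₁ * vc ^ (-1 : ℤ)) :
    |vc ^ (-1 : ℤ) * ∑ y ∈ Ys, w y ^ (d : ℤ) * kQc y * (w y ^ (-1 : ℤ) * Dv y)|
      ≤ O₁ * K₁ * (4 * C₂ * ε₃ ^ 2) * vc ^ (-4 : ℤ) := by
  have hM : 0 ≤ 4 * C₂ * ε₃ ^ 2 := by positivity
  have hg : ∀ y ∈ Ys, |w y ^ (-1 : ℤ) * Dv y| ≤ 4 * C₂ * ε₃ ^ 2 * w y ^ (-1 : ℤ) := by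
    intro y hy
    have hw1 : 0 < w y ^ (-1 : ℤ) := zpow_pos (hw y hy) _
    rw [abs_mul, abs_of_pos hw1]
    calc w y ^ (-1 : ℤ) * |Dv y| ≤ w y ^ (-1 : ℤ) * (4 * C₂ * ε₃ ^ 2) :=
          mul_le_mul_of_nonneg_left (h55 y hy) hw1.le
      _ = 4 * C₂ * ε₃ ^ 2 * w y ^ (-1 : ℤ) := by ring
  have hS := kernel3132_sum_le Ys w kQc (fun y => w y ^ (-1 : ℤ) * Dv y) dYc d vc O₁ δ₁ (4 * C₂ * ε₃ ^ 2) K₁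
    hvc hw hO hM h3132c hg hL1c
  have hv1 : 0 < vc ^ (-1 : ℤ) := zpow_pos hvc _
  have e : vc ^ (-1 : ℤ) * vc ^ (-3 : ℤ) = vc ^ (-4 : ℤ) := by rw [← zpow_add₀ hvc.ne']; norm_num
  rw [abs_mul, abs_of_pos hv1]
  calc vc ^ (-1 : ℤ) * |∑ y ∈ Ys, w y ^ (d : ℤ) * kQc y * (w y ^ (-1 : ℤ) * Dv y)|
      ≤ vc ^ (-1 : ℤ) * (O₁ * (4 * C₂ * ε₃ ^ 2) * K₁ * vc ^ (-3 : ℤ)) := mul_le_mul_of_nonneg_left hS hv1.le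
    _ = O₁ * K₁ * (4 * C₂ * ε₃ ^ 2) * (vc ^ (-1 : ℤ) * vc ^ (-3 : ℤ)) := by ring
    _ = O₁ * K₁ * (4 * C₂ * ε₃ ^ 2) * vc ^ (-4 : ℤ) := by rw [e]

/-- **The estimate sentence of (89)**, p. 291: «𝔇*(A′)H*Δ_πHD(A′) = 𝔇*(A′)(L^{j(·)}η)⁻¹(QGQ*)⁻¹(L^{j(·)}η)⁻¹D(A′) [−]
𝔇*(A′)(L^{j(·)}η)⁻⁴D(A′), (89) and can be estimated by O(1)ε₃³(Lʲη)⁻³ on Ω_j» — the two `𝔇*`-sums of §2 with the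
inner sizes `O₁K₁4C₂ε₃²` (`phi89_term1`) and `4C₂ε₃²` ((55) with `(L^{j(·)}η)⁻⁴`):
`|(89)(b)| ≦ (O₂C₃O₁K₁K₂4C₂ + O₂C₃K₂4C₂)·ε₃³·(Lʲη)⁻³`, whatever the unprinted sign.
[cite: Balaban1985Variational, (89) p.291] -/
theorem ineq89 (Cs : Finset C) (v Dk F₁ Dvc dC : C → ℝ) (d : ℕ) (t O₂C₃ δ ε₃ O₁ K₁ C₂ K₂ σ : ℝ)
    (ht : 0 < t) (hv : ∀ c ∈ Cs, 0 < v c) (hO₂ : 0 ≤ O₂C₃) (hε : 0 ≤ ε₃) (hO₁ : 0 ≤ O₁) (hK₁ : 0 ≤ K₁)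
    (hC : 0 ≤ C₂) (hσ : σ = 1 ∨ σ = -1)
    (h73 : ∀ c ∈ Cs, |Dk c| ≤ O₂C₃ * ε₃ * t ^ (1 - (d : ℤ)) * exp (-(δ * dC c)))
    (hF₁ : ∀ c ∈ Cs, |F₁ c| ≤ O₁ * K₁ * (4 * C₂ * ε₃ ^ 2) * v c ^ (-4 : ℤ))
    (h55c : ∀ c ∈ Cs, |Dvc c| ≤ 4 * C₂ * ε₃ ^ 2)
    (hL2 : ∑ c ∈ Cs, v c ^ ((d : ℤ) - 4) * exp (-(δ * dC c)) ≤ K₂ * t ^ ((d : ℤ) - 4)) :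
    |∑ c ∈ Cs, v c ^ (d : ℤ) * Dk c * F₁ c + σ * ∑ c ∈ Cs, v c ^ (d : ℤ) * Dk c * (v c ^ (-4 : ℤ) * Dvc c)|
      ≤ (O₂C₃ * O₁ * K₁ * K₂ * 4 * C₂ + O₂C₃ * K₂ * 4 * C₂) * ε₃ ^ 3 * t ^ (-3 : ℤ) := by
  have hA : |∑ c ∈ Cs, v c ^ (d : ℤ) * Dk c * F₁ c| ≤ O₂C₃ * ε₃ * (O₁ * K₁ * (4 * C₂ * ε₃ ^ 2)) * K₂ * t ^ (-3 : ℤ) :=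
    dstar73_sum_le Cs v Dk F₁ dC d t (O₂C₃ * ε₃) δ (O₁ * K₁ * (4 * C₂ * ε₃ ^ 2)) K₂ ht hv (by positivity)
      (by positivity) h73 hF₁ hL2
  have hF₂ : ∀ c ∈ Cs, |v c ^ (-4 : ℤ) * Dvc c| ≤ 4 * C₂ * ε₃ ^ 2 * v c ^ (-4 : ℤ) := by
    intro c hc
    have hv4 : 0 < v c ^ (-4 : ℤ) := zpow_pos (hv c hc) _
    rw [abs_mul, abs_of_pos hv4]
    calc v c ^ (-4 : ℤ) * |Dvc c| ≤ v c ^ (-4 : ℤ) * (4 * C₂ * ε₃ ^ 2) := mul_le_mul_of_nonneg_left (h55c c hc) hv4.le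
      _ = 4 * C₂ * ε₃ ^ 2 * v c ^ (-4 : ℤ) := by ring
  have hB : |∑ c ∈ Cs, v c ^ (d : ℤ) * Dk c * (v c ^ (-4 : ℤ) * Dvc c)| ≤ O₂C₃ * ε₃ * (4 * C₂ * ε₃ ^ 2) * K₂ * t ^ (-3 : ℤ) :=
    dstar73_sum_le Cs v Dk (fun c => v c ^ (-4 : ℤ) * Dvc c) dC d t (O₂C₃ * ε₃) δ (4 * C₂ * ε₃ ^ 2) K₂ ht hv
      (by positivity) (by positivity) h73 hF₂ hL2
  have hσ1 : |σ| = 1 := by rcases hσ with h | h <;> simp [h]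
  calc |∑ c ∈ Cs, v c ^ (d : ℤ) * Dk c * F₁ c + σ * ∑ c ∈ Cs, v c ^ (d : ℤ) * Dk c * (v c ^ (-4 : ℤ) * Dvc c)|
      ≤ |∑ c ∈ Cs, v c ^ (d : ℤ) * Dk c * F₁ c| + |σ * ∑ c ∈ Cs, v c ^ (d : ℤ) * Dk c * (v c ^ (-4 : ℤ) * Dvc c)| :=
        abs_add_le _ _
    _ = |∑ c ∈ Cs, v c ^ (d : ℤ) * Dk c * F₁ c| + |∑ c ∈ Cs, v c ^ (d : ℤ) * Dk c * (v c ^ (-4 : ℤ) * Dvc c)| := by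
        rw [abs_mul, hσ1, one_mul]
    _ ≤ O₂C₃ * ε₃ * (O₁ * K₁ * (4 * C₂ * ε₃ ^ 2)) * K₂ * t ^ (-3 : ℤ)
        + O₂C₃ * ε₃ * (4 * C₂ * ε₃ ^ 2) * K₂ * t ^ (-3 : ℤ) := add_le_add hA hB
    _ = (O₂C₃ * O₁ * K₁ * K₂ * 4 * C₂ + O₂C₃ * K₂ * 4 * C₂) * ε₃ ^ 3 * t ^ (-3 : ℤ) := by ring

end Literature.MathematicalPhysics.QuantumFieldTheory.Balaban1983to89.B11Eq88Estimate
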